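import Summits.HodgeConjecture.HodgeConjecture.Cruxes.BlochSeedDiscOne.PortHallLegSurplus
import Summits.HodgeConjecture.HodgeConjecture.Cruxes.BlochSeedDiscOne.PatternedPorteous

/-!
line stmt-HodgeConjecture-18881 Cruxes/BlochSeedDiscOne/Lines/birth.lean 814a6a70c14e831a stub_rung_pad4_seedAt

# PortHall₈ ROW-α2 — THE EXACT ROW `GClean` (THEOREM G (c) typed and kernel-decidable); `TheoremG` ∕ `LemmaL` TYPED (pen, NOT proved here); G ∧ L ⟹ Q1N (v2)

Unit `plan-lens-HodgeAV-negation-g26` (CLAIM-FREE, evidence only), crux `BlochSeedDiscOne` (stmt-HodgeConjecture-18881); memo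
`Cruxes/BlochSeedDiscOne/PORTHALL8-ROW-A2-negation-g26.md` v1.6 §4quinquies (officer ∕ critic idea-crit-6 READ #10 (f), bus l.13961: THEOREM G PASS ×2 ·
LEMMA L PASS ×2 · THEOREM Q1 PASS ×2; director R19.901 l.13966: accounting of record «a row-6′ kill owes NOTHING on any design»).

WHAT THIS FILE DOES (additive vocabulary; imports BUILT crux workfiles only; 0 `sorry` · 0 `axiom` · no `instance` ∕ `notation` ∕ new inductive ∕
`native_decide`):
* §1 types the objects of THEOREM G (c) as COMPUTABLE functions of a `DepthBoundA4.Design` (entry level, zero-multiplicity entries dropped):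
  `Γ(U)` (`gammaU`), `U(𝔍)` (`seenBy`), the joint rank `g_U(𝔍) = Σ_f r_f` of the live steps (`gRank`; `r_f = 0` no leg on the factor, `1` all legs NULL and
  proportional — one kernel elliptic curve —, `2` otherwise), the number `c_U(𝔍)` of connected components of the live bipartite graph on `U(𝔍) ⊔ 𝔍`
  (`numComp`), and the row  `GClean E :⟺ ∀ ∅ ≠ U ⊆ senders, ∃ ∅ ≠ 𝔍 ⊆ Γ(U) : n_𝔍 + c_U(𝔍) ≥ m(U(𝔍)) + g_U(𝔍) + 1`  (`gCleanB`, Bool-valued, so every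
  closed instance is decided by `decide`).  Entry level ⟺ type level: a sub-entry `U` only lowers `m(U(𝔍))` with the same `c`, `g`; a sub-entry `𝔍` never
  helps the `∃`.
* §2 TYPES (does NOT prove) the two pen statements of the memo as named `Prop`s — `TheoremG : ∀ E, GClean E ↔ PPClean weakB E`, `LemmaL : ∀ E,
  E.N.Nodup → GClean E → HallPlusLegUp E` — with the one-line reductions `theoremQ1N_of` (G → L → Q1N, Q1N spelled as the REPAIRED shell of record
  `∀ D, D.N.Nodup → PPClean weakB D → HallPlusLegUp D` = hsemireg-c5c8-1 g56's `TheoremQ1N`, director (Q1-k′) R19.917 l.14118 — not redeclared here),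
  `theoremQ1Nc_of` (the same under the cell-level normal form `(D.N.map Prod.fst).Nodup` of shadows, R19.918) and `not_ppClean_of_not_hallPlusLegUp`
  (under G, L and `N.Nodup` a row-6′ violation is a row-6 violation).  TYPED ≠ PROVED: the proofs are PEN (memo §4quinquies), read ×2.
* §2b (v2) ERRATUM IN KERNEL.  v1 of this file (eef21cfe8ae80a61) typed `LemmaL` — and through it Q1 — over ALL `D : Design` with NO `Nodup` hypothesis;
  that typing is FALSE at the list level, exactly as c5c8-1 g56 found for `SeedChecker.SplitBlock.TheoremQ1` (NOTE-1 l.14116; officer ×2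
  `CriticQ1Dup.not_theoremQ1` f766c40a7c7c09ac l.14121; booked R19.917 ∕ R19.918): the witness `Ddup = ⟨[(y3,1),(y3,1)], [(xn4,1)]⟩` (`NUL4m1n2` with its
  N entry split into two byte-equal list entries) is G-clean AND PP-clean (both rows AGGREGATE masses over entries: `n = 2`) but violates `HallPlusLegUp`,
  whose covering clause `cn ∈ T` is MEMBERSHIP, so `T = [(y3,1)]` (mass 1) covers both copies.  Landed here: `ddup_gClean`, `ddup_ppClean`,
  `ddup_not_hallPlusLegUp`, `not_lemmaL_unguarded : ¬ ∀ E, GClean E → HallPlusLegUp E` (the v1 typing refuted, class MISSTATED at the list level; the pen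
  LEMMA L ∕ THEOREM Q1 speak of designs = multisets of pairwise-distinct cells and are untouched), and `TheoremG` is NOT refuted by the witness (both sides
  aggregate) — §3b runs the officer's degenerate-list battery (duplicate pairs, split multiplicities, zero-multiplicity entries, empty N ∕ P; LADDER POLICY
  R19.918) against `TheoremG`: `gCleanB = ppCleanB weakB` on all eleven degenerate designs, so `TheoremG` keeps its unguarded typing.
* §3 KERNEL INSTANCES of THEOREM G: on the small typed toys of the crux directory (`MIXA`, `MIXB`, `NUL4m1n1`, `NUL4m1n2`, `NUL1m1n2`, `LEG3m1n2`,
  `LEG3m1n3`, `C1`, `C2`, and re-typed copies `TMIX`, `TMIX2`, `TNULA`, `TNULB`, `TD3` of `PortHallRhoRow`'s `DMIX`, `DMIX2`, `DNULA`, `DNULB` and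
  `PortHallStarRow`'s `D3` — those two modules are not imported) and on a threshold pair of the memo's numerics (§4quater table, seed 71:
  a two-sender patterned design, dirty one below the threshold and clean at it) the kernel evaluates `gCleanB E = ppCleanB weakB E`
  (`decide +kernel`; 16 designs, 32 evaluations).  These are INSTANCES, not a proof of `TheoremG`.

HONEST: letters ≠ sheaves ≠ SEED; nothing here proves 18881 ∕ H2 ∕ HC_AV ∕ HC_CM ∕ HC; `TheoremG`, `LemmaL` are TYPED (open in the tree), their proofs
are pen; the §3 theorems are closed-term INSTANCES; no skeleton ∕ stub ∕ `Lines/*` is touched; `TheoremG` ∕ `LemmaL` are hypotheses of no record;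
v1's unguarded `LemmaL` is refuted here in kernel (`not_lemmaL_unguarded`) and superseded, not reworded silently.
-/

set_option linter.dupNamespace false
set_option autoImplicit false

namespace Summit.HodgeConjecture.HodgeConjecture.Cruxes.BlochSeedDiscOne.PortHallG

open Summit.HodgeConjecture.HodgeConjecture.Cruxes.BlochSeedDiscOne.DepthBoundA4
open Summit.HodgeConjecture.HodgeConjecture.Cruxes.BlochSeedDiscOne.LeggedFloor
open Summit.HodgeConjecture.HodgeConjecture.Cruxes.BlochSeedDiscOne.HallB136
open Summit.HodgeConjecture.HodgeConjecture.Cruxes.BlochSeedDiscOne.RuleDPlate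
open Summit.HodgeConjecture.HodgeConjecture.Cruxes.BlochSeedDiscOne.PortHallLeg
open Summit.HodgeConjecture.HodgeConjecture.Cruxes.BlochSeedDiscOne.PatternedPorteous

/-! ## §1 The objects of THEOREM G (c), computable -/

/-- the kind of a NON-EQUAL factor step, as in `PortHallRhoRow.lean` (restated here so that this file imports only the two long-built modules):
`none` = AMPLE, `some (Δa, Δx, Δy)` = NULL with its difference vector (isotropic: `Δx² + Δy² = Δa²`). -/
abbrev StepVec := Option (ℤ × ℤ × ℤ)

/-- the step kind of `ℓ → ℓ'`; the OUTER `none` means the letters are EQUAL (no leg on this factor). -/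
def stepVec (ℓ ℓ' : Letter) : Option StepVec :=
  if ℓ = ℓ' then none
  else if (ℓ'.x - ℓ.x) ^ 2 + (ℓ'.y - ℓ.y) ^ 2 = (ℓ'.a - ℓ.a) ^ 2 then some (some (ℓ'.a - ℓ.a, ℓ'.x - ℓ.x, ℓ'.y - ℓ.y))
  else some none

/-- two null steps are PROPORTIONAL (same kernel elliptic curve on the factor `E₀²`). -/
def propVec : StepVec → StepVec → Bool
  | some (a, x, y), some (a', x', y') => a * x' == a' * x && a * y' == a' * y && x * y' == x' * y
  | _, _ => false

/-- mass `Σ m` of a list of entries. -/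
def mass (L : List (Cell × ℕ)) : ℕ := (L.map Prod.snd).sum

/-- sender entries (P side, positive multiplicity). -/
def senders (E : Design) : List (Cell × ℕ) := E.P.filter fun cm => decide (0 < cm.2)

/-- receiver entries (N side, positive multiplicity). -/
def receivers (E : Design) : List (Cell × ℕ) := E.N.filter fun cn => decide (0 < cn.2)

/-- `Γ(U)`: the receiver entries weakly live to some sender of `U`. -/
def gammaU (E : Design) (U : List (Cell × ℕ)) : List (Cell × ℕ) :=
  (receivers E).filter fun cn => U.any fun cm => weakLiveB cm.1 cn.1

/-- `U(𝔍)`: the senders of `U` weakly live to some receiver of `𝔍`. -/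
def seenBy (U J : List (Cell × ℕ)) : List (Cell × ℕ) := U.filter fun cm => J.any fun cn => weakLiveB cm.1 cn.1

/-- all sub-lists of a list (structural; `2^{|L|}` of them). -/
def subl {α : Type} : List α → List (List α)
  | [] => [[]]
  | a :: l => subl l ++ (subl l).map fun s => a :: s

/-- joint rank `r_f ∈ {0,1,2}` of a list of NON-EQUAL step kinds on one factor `E₀²` (`none` = AMPLE, `some v` = NULL with difference vector `v`):
`0` if there is no step, `2` if some step is ample or two null steps are not proportional (two distinct kernel curves meet in finitely many points),
`1` if all steps are null and pairwise proportional (one kernel elliptic curve). -/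
def factorRank : List StepVec → ℕ
  | [] => 0
  | k :: rest => if (k :: rest).any Option.isNone then 2 else if rest.all (propVec k) then 1 else 2

/-- the non-equal step kinds on factor `f` of the weakly-live pairs `σ → τ`, `σ ∈ U`, `τ ∈ 𝔍`. -/
def stepsAt (U J : List (Cell × ℕ)) (f : Fin 4) : List StepVec :=
  U.foldr (fun cm acc => ((J.filter fun cn => weakLiveB cm.1 cn.1).filterMap fun cn => stepVec (cm.1 f) (cn.1 f)) ++ acc) []

/-- `g_U(𝔍) = Σ_f r_f`: the codimension of the connected common kernel of the live classes. -/
def gRank (U J : List (Cell × ℕ)) : ℕ :=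
  factorRank (stepsAt U J 0) + factorRank (stepsAt U J 1) + factorRank (stepsAt U J 2) + factorRank (stepsAt U J 3)

/-- a vertex of the live bipartite graph: `(false, σ)` a sender, `(true, τ)` a receiver. -/
abbrev Vtx := Bool × Cell

/-- adjacency: a sender and a receiver joined by a weakly-live arrow. -/
def adjB (v w : Vtx) : Bool :=
  match v, w with
  | (false, σ), (true, τ) => weakLiveB σ τ
  | (true, τ), (false, σ) => weakLiveB σ τ
  | _, _ => false

/-- vertex equality as a Bool. -/
def vtxEqB (v w : Vtx) : Bool := (v.1 == w.1) && cellEqB v.2 w.2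

/-- one breadth-first step inside the vertex list `V`. -/
def grow (V S : List Vtx) : List Vtx := S ++ V.filter fun w => S.any fun v => adjB v w

/-- `n` breadth-first steps. -/
def reach (V : List Vtx) : ℕ → List Vtx → List Vtx
  | 0, S => S
  | n + 1, S => reach V n (grow V S)

/-- `w` is in the connected component of `v` (inside `V`). -/
def connB (V : List Vtx) (v w : Vtx) : Bool := (reach V V.length [v]).any fun u => vtxEqB u w

/-- count the vertices not connected to an earlier one (= number of connected components; repeated vertices are not recounted). -/
def numCompAux (V : List Vtx) : List Vtx → List Vtx → ℕ
  | _, [] => 0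
  | pre, v :: rest => (if pre.any fun w => connB V w v then 0 else 1) + numCompAux V (v :: pre) rest

/-- the vertex list `U(𝔍) ⊔ 𝔍`. -/
def verts (UJ J : List (Cell × ℕ)) : List Vtx := (UJ.map fun cm => (false, cm.1)) ++ J.map fun cn => (true, cn.1)

/-- `c_U(𝔍)`: number of connected components of the live bipartite graph on `U(𝔍) ⊔ 𝔍`. -/
def numComp (UJ J : List (Cell × ℕ)) : ℕ := numCompAux (verts UJ J) [] (verts UJ J)

/-- the witness test of THEOREM G (c) for `(U, 𝔍)`: `𝔍 ≠ ∅` and `n_𝔍 + c_U(𝔍) ≥ m(U(𝔍)) + g_U(𝔍) + 1`. -/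
def witnessB (U J : List (Cell × ℕ)) : Bool :=
  !J.isEmpty && decide (mass (seenBy U J) + gRank U J + 1 ≤ mass J + numComp (seenBy U J) J)

/-- **THEOREM G (c) as a Bool**: every non-empty sender sub-list `U` has a witness `𝔍 ⊆ Γ(U)`. -/
def gCleanB (E : Design) : Bool :=
  (subl (senders E)).all fun U => U.isEmpty || (subl (gammaU E U)).any fun J => witnessB U J

/-- **the exact row** `GClean` (= THEOREM G (c) of memo v1.6 §4quinquies; by the pen THEOREM G it is LAW PP in closed form). -/
def GClean (E : Design) : Prop := gCleanB E = true

/-! ## §2 The pen statements, TYPED (not proved here) -/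

/-- **THEOREM G** (pen, memo §4quinquies; officer READ #10 (f) PASS ×2): the exact row is LAW PP.  TYPED ONLY. -/
def TheoremG : Prop := ∀ E : Design, GClean E ↔ PPClean weakB E

/-- **LEMMA L** (pen, memo §4quinquies; READ #10 (f) PASS ×2): on a design whose N-list has no repeated entry, the exact row implies the leg-surplus
row 6′.  TYPED ONLY.  (v2: the hypothesis `E.N.Nodup` is the list-level transcription of «a design is a multiset of pairwise-distinct cells»; pair-level
`Nodup` suffices — distinct pairs on one cell are all forced into `T` and their masses add — and the shadows' cell-level normal form implies it,
`theoremQ1Nc_of`.  v1 typed it with no such hypothesis: refuted below, `not_lemmaL_unguarded`.) -/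
def LemmaL : Prop := ∀ E : Design, E.N.Nodup → GClean E → HallPlusLegUp E

/-- the assembly of the pen proof: THEOREM G and LEMMA L give THEOREM Q1N — the repaired shell of record `∀ D, D.N.Nodup → PPClean weakB D →
HallPlusLegUp D` (director (Q1-k′) R19.917; hsemireg-c5c8-1 g56's `TheoremQ1N`, spelled out here so that this file keeps its two light imports). -/
theorem theoremQ1N_of (hG : TheoremG) (hL : LemmaL) : ∀ E : Design, E.N.Nodup → PPClean weakB E → HallPlusLegUp E :=
  fun E hN h => hL E hN ((hG E).2 h)

/-- the same under the cell-level normal form of shadows (`shadowCell` injective ⟹ `(N.map Prod.fst).Nodup`, officer remark (r) l.14121 ∕ R19.918). -/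
theorem theoremQ1Nc_of (hG : TheoremG) (hL : LemmaL) : ∀ E : Design, (E.N.map Prod.fst).Nodup → PPClean weakB E → HallPlusLegUp E :=
  fun E hN h => theoremQ1N_of hG hL E (List.Nodup.of_map _ hN) h

/-- under G and L a row-6′ (`HallPlusLegUp`) violation on a duplicate-free design is a row-6 (LAW PP) violation: a LEG kill owes nothing (R19.901). -/
theorem not_ppClean_of_not_hallPlusLegUp (hG : TheoremG) (hL : LemmaL) {E : Design} (hN : E.N.Nodup) (h : ¬ HallPlusLegUp E) :
    ¬ PPClean weakB E :=
  fun hp => h (theoremQ1N_of hG hL E hN hp)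

/-! ## §2b (v2) The duplicate-entry witness: v1's unguarded `LemmaL` refuted in kernel; `TheoremG` not hit -/

/-- hsemireg-c5c8-1 g56's witness (NOTE-1 l.14116; officer ×2 `CriticQ1Dup` f766c40a7c7c09ac): `NUL4m1n2 = ⟨[(y3,2)], [(xn4,1)]⟩` with its N entry split
into two byte-equal list entries. -/
def Ddup : Design := ⟨[(y3, 1), (y3, 1)], [(xn4, 1)]⟩

/-- its N-list is not duplicate-free (so `LemmaL` ∕ `TheoremQ1N` do not speak of it). -/
theorem ddup_N_not_nodup : ¬ Ddup.N.Nodup := by decide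

/-- both aggregated rows call it clean (`n = 2`, `m = 1`, one null leg, `c = 1`, `g = 1`: `2 + 1 ≥ 1 + 1 + 1`). -/
theorem ddup_gClean : gCleanB Ddup = true ∧ ppCleanB weakB Ddup = true := by
  refine ⟨?_, ?_⟩ <;> decide +kernel

/-- … while the membership-covering row 6′ fails on it: `S = [(xn4,1)]`, `T = [(y3,1)] ⊑ N` covers both copies, `d = 1 = pairDim xn4 y3`, `1 + 1 ≤ 1`. -/
theorem ddup_not_hallPlusLegUp : ¬ HallPlusLegUp Ddup := by
  intro h
  unfold HallPlusLegUp at h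
  have h1 := h [(xn4, 1)] (List.Sublist.refl _) (by decide) [(y3, 1)] (List.Sublist.cons _ (List.Sublist.refl _))
    (by intro cn hcn _; simp [Ddup] at hcn; simp [hcn]) 1 (by decide)
    (by intro cm hcm cn hcn _; simp at hcm hcn; subst hcm; subst hcn; decide +kernel)
  simp at h1

/-- **v1's typing of LEMMA L (no `Nodup`) is false** — refuted-MISSTATED at the list level; the repaired statement is `LemmaL` above. -/
theorem not_lemmaL_unguarded : ¬ (∀ E : Design, GClean E → HallPlusLegUp E) :=
  fun h => ddup_not_hallPlusLegUp (h Ddup ddup_gClean.1)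

/-! ## §3 Kernel instances of THEOREM G (`gCleanB = ppCleanB weakB` on closed terms) -/

/-! ### §3b (v2) the officer's degenerate-list battery (LADDER POLICY R19.918) against `TheoremG`: duplicate pairs (`Ddup` above, `DdupP`), split
multiplicities (`DsplitN`, `DsplitP`), zero-multiplicity entries (`Dzero1`–`Dzero3`), empty N ∕ P (`DemptyN`, `DemptyP`, `Dempty`) — the two Bool rows
agree on all of them (stated as equalities, so only a disagreement could fail). -/

/-- duplicate P entries. -/ def DdupP : Design := ⟨[(y3, 2)], [(xn4, 1), (xn4, 1)]⟩
/-- split N multiplicity, distinct pairs. -/ def DsplitN : Design := ⟨[(y3, 1), (y3, 2)], [(xn4, 1)]⟩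
/-- split P multiplicity, distinct pairs. -/ def DsplitP : Design := ⟨[(y3, 3)], [(xn4, 1), (xn4, 2)]⟩
/-- zero-multiplicity entries next to live ones. -/ def Dzero1 : Design := ⟨[(y3, 2), (y3, 0)], [(xn4, 1), (xn4, 0)]⟩
/-- a zero-mass receiver only. -/ def Dzero2 : Design := ⟨[(y3, 0)], [(xn4, 1)]⟩
/-- a zero-mass sender only. -/ def Dzero3 : Design := ⟨[(y3, 1)], [(xn4, 0)]⟩
/-- empty N. -/ def DemptyN : Design := ⟨[], [(xn4, 1)]⟩
/-- empty P. -/ def DemptyP : Design := ⟨[(y3, 1)], []⟩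
/-- empty design. -/ def Dempty : Design := ⟨[], []⟩

theorem thmG_degenerate_dup : gCleanB DdupP = ppCleanB weakB DdupP ∧ gCleanB DsplitN = ppCleanB weakB DsplitN ∧
    gCleanB DsplitP = ppCleanB weakB DsplitP := by
  refine ⟨?_, ?_, ?_⟩ <;> decide +kernel

theorem thmG_degenerate_zero : gCleanB Dzero1 = ppCleanB weakB Dzero1 ∧ gCleanB Dzero2 = ppCleanB weakB Dzero2 ∧
    gCleanB Dzero3 = ppCleanB weakB Dzero3 := by
  refine ⟨?_, ?_, ?_⟩ <;> decide +kernel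

theorem thmG_degenerate_empty : gCleanB DemptyN = ppCleanB weakB DemptyN ∧ gCleanB DemptyP = ppCleanB weakB DemptyP ∧
    gCleanB Dempty = ppCleanB weakB Dempty := by
  refine ⟨?_, ?_, ?_⟩ <;> decide +kernel

/-! ### the toys of record -/

/-- monad-3's MIX-A ∕ MIX-B (an ample leg and a hub; `PatternedPorteous`). -/
theorem thmG_toys_MIX : gCleanB MIXA = true ∧ ppCleanB weakB MIXA = true ∧ gCleanB MIXB = false ∧ ppCleanB weakB MIXB = false := by
  refine ⟨?_, ?_, ?_, ?_⟩ <;> decide +kernel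

/-- monad-3's null-leg toys (content 4 and content 1). -/
theorem thmG_toys_NUL :
    gCleanB NUL4m1n1 = false ∧ ppCleanB weakB NUL4m1n1 = false ∧ gCleanB NUL4m1n2 = true ∧ ppCleanB weakB NUL4m1n2 = true ∧
    gCleanB NUL1m1n2 = true ∧ ppCleanB weakB NUL1m1n2 = true := by
  refine ⟨?_, ?_, ?_, ?_, ?_, ?_⟩ <;> decide +kernel

/-- monad-3's three-ample-leg toys. -/
theorem thmG_toys_LEG3 :
    gCleanB LEG3m1n2 = false ∧ ppCleanB weakB LEG3m1n2 = false ∧ gCleanB LEG3m1n3 = true ∧ ppCleanB weakB LEG3m1n3 = true := by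
  refine ⟨?_, ?_, ?_, ?_⟩ <;> decide +kernel

/-- the two PP-clean PortHall₈-violators `C1` (a content-1 null leg) and `C2` (an ample leg under the hub) of `PortHallLegSurplus`. -/
theorem thmG_toys_C1_C2 : gCleanB C1 = true ∧ ppCleanB weakB C1 = true ∧ gCleanB C2 = true ∧ ppCleanB weakB C2 = true := by
  refine ⟨?_, ?_, ?_, ?_⟩ <;> decide +kernel

/-- the mixed toys of `PortHallRhoRow` re-typed (same letters; that module is not imported here): `σ = (3;2,2)⁴`, `τ₁` ∕ `τ₂` ample above `σ` on
factor 0 ∕ 1 only; `TMIX = DMIX` (`σ ×1` under `τ₁ ×2, τ₂ ×2`), `TMIX2 = DMIX2` (`σ ×2` under `τ₁ ×3, τ₂ ×3`). -/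
def tSig : Cell := PatternedPorteous.cellOf lL lL lL lL
/-- `τ₁`. -/ def tTauA : Cell := PatternedPorteous.cellOf l7 lL lL lL
/-- `τ₂`. -/ def tTauB : Cell := PatternedPorteous.cellOf lL l7 lL lL
/-- `= PortHallRho.DMIX`. -/ def TMIX : Design := ⟨[(tTauA, 2), (tTauB, 2)], [(tSig, 1)]⟩
/-- `= PortHallRho.DMIX2`. -/ def TMIX2 : Design := ⟨[(tTauA, 3), (tTauB, 3)], [(tSig, 2)]⟩

/-- the Hodge-index toys of `PortHallRhoRow` re-typed: `TNULA = DNULA` (`σ ×1` under two receivers with NON-proportional null legs on factor 3: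
`(3;2,2) → (4;1,2)` and `→ (4;2,1)`), `TNULB = DNULB` (PROPORTIONAL null legs: `→ (4;1,2)` and `→ (5;0,2)`). -/
def tRP : Cell := PatternedPorteous.cellOf lL lL lL ⟨4, 1, 2⟩
/-- `(4;2,1)` leg. -/ def tRQ : Cell := PatternedPorteous.cellOf lL lL lL ⟨4, 2, 1⟩
/-- `(5;0,2)` leg. -/ def tRR : Cell := PatternedPorteous.cellOf lL lL lL ⟨5, 0, 2⟩
/-- `= PortHallRho.DNULA`. -/ def TNULA : Design := ⟨[(tRP, 1), (tRQ, 1)], [(tSig, 1)]⟩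
/-- `= PortHallRho.DNULB`. -/ def TNULB : Design := ⟨[(tRP, 1), (tRR, 1)], [(tSig, 1)]⟩

set_option maxHeartbeats 800000 in
theorem thmG_toys_mixed :
    gCleanB TMIX = false ∧ ppCleanB weakB TMIX = false ∧ gCleanB TMIX2 = true ∧ ppCleanB weakB TMIX2 = true ∧
    gCleanB TNULA = false ∧ ppCleanB weakB TNULA = false ∧ gCleanB TNULB = true ∧ ppCleanB weakB TNULB = true := by
  refine ⟨?_, ?_, ?_, ?_, ?_, ?_, ?_, ?_⟩ <;> decide +kernel

/-- the leg-free non-star design `D3` of `PortHallStarRow` re-typed (`TD3 = PortHallLeg.D3`: senders `(10;2,2)⁴ ×2`, `(10;−2,−2)⁴ ×2`, receivers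
`(12;1,1)⁴ ×1`, `(12;−1,−1)⁴ ×1`, hub `(14;0,0)⁴ ×9`; one dead corner each way): both rows refute it. -/
def tDS1 : Cell := PatternedPorteous.cellOf ⟨10, 2, 2⟩ ⟨10, 2, 2⟩ ⟨10, 2, 2⟩ ⟨10, 2, 2⟩
/-- `(10;−2,−2)⁴`. -/ def tDS2 : Cell := PatternedPorteous.cellOf ⟨10, -2, -2⟩ ⟨10, -2, -2⟩ ⟨10, -2, -2⟩ ⟨10, -2, -2⟩
/-- `(12;1,1)⁴`. -/ def tDT1 : Cell := PatternedPorteous.cellOf ⟨12, 1, 1⟩ ⟨12, 1, 1⟩ ⟨12, 1, 1⟩ ⟨12, 1, 1⟩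
/-- `(12;−1,−1)⁴`. -/ def tDT2 : Cell := PatternedPorteous.cellOf ⟨12, -1, -1⟩ ⟨12, -1, -1⟩ ⟨12, -1, -1⟩ ⟨12, -1, -1⟩
/-- `= PortHallLeg.D3`. -/ def TD3 : Design := ⟨[(tDT1, 1), (tDT2, 1), (hub4h14, 9)], [(tDS1, 2), (tDS2, 2)]⟩

set_option maxHeartbeats 1600000 in
theorem thmG_TD3 : gCleanB TD3 = false ∧ ppCleanB weakB TD3 = false := by
  refine ⟨?_, ?_⟩ <;> decide +kernel

/-- threshold pair 1 of the memo's numerics (seed 71, `j = 1`, threshold `5`): two patterned senders (masses 3, 1), three receivers. -/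
def gxS1 : Cell := PatternedPorteous.cellOf ⟨12, 1, 1⟩ ⟨12, 1, 1⟩ ⟨12, 2, 0⟩ ⟨12, 1, 1⟩
def gxS2 : Cell := PatternedPorteous.cellOf ⟨12, 1, 1⟩ ⟨13, 1, 0⟩ ⟨12, 1, 1⟩ ⟨12, 1, 1⟩
def gxR1 : Cell := PatternedPorteous.cellOf ⟨13, 0, 1⟩ ⟨13, 1, 0⟩ ⟨13, 1, 0⟩ ⟨14, 0, 0⟩
def gxR2 : Cell := PatternedPorteous.cellOf ⟨13, 0, 1⟩ ⟨13, 0, 1⟩ ⟨12, 2, 0⟩ ⟨12, 1, 1⟩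
def gxR3 : Cell := PatternedPorteous.cellOf ⟨13, 1, 0⟩ ⟨13, 1, 0⟩ ⟨12, 1, 1⟩ ⟨12, 1, 1⟩
/-- below the threshold (`n₂ = 4`). -/
def GX1a : Design := ⟨[(gxR1, 2), (gxR2, 4), (gxR3, 3)], [(gxS1, 3), (gxS2, 1)]⟩
/-- at the threshold (`n₂ = 5`). -/
def GX1b : Design := ⟨[(gxR1, 2), (gxR2, 5), (gxR3, 3)], [(gxS1, 3), (gxS2, 1)]⟩

set_option maxHeartbeats 1600000 in
theorem thmG_GX1 : gCleanB GX1a = false ∧ ppCleanB weakB GX1a = false ∧ gCleanB GX1b = true ∧ ppCleanB weakB GX1b = true := by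
  refine ⟨?_, ?_, ?_, ?_⟩ <;> decide +kernel

end Summit.HodgeConjecture.HodgeConjecture.Cruxes.BlochSeedDiscOne.PortHallG
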